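import Summits.Ventures.CertifiedManyBodySolver.Transport.LTIPrimalHubbardChain
import HarnessLib

/-!
# Ventures/CertifiedManyBodySolver — Transport/LTIPrimalHubbardChainWindow.lean

Speedrun cell sr-mbsolver — LIT team (lit-1 gen-5), D-16 r36 / D-18 r72(c).
HONEST FRAMING: first certified bounds; not a superconductivity verdict; every number certified or labelled float.

The CANONICAL WINDOW of a lane-B `relax = lti(n)` Hubbard-chain row, `n + 3` consecutive sites `{-1, 0, 1, …, n+1} ⊂ ℤ`
(`chainWindow (-1) (n+1)`), its left sub-window `{-1, …, n}` (`chainWindow (-1) n`) and the unit translation: all window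
hypotheses of `lti_primal_chain_energyPerSite_ge` (`Transport/LTIPrimalHubbardChain.lean`) — inclusion, translate inside the
window, `{-1,0,1} ⊆` window, initial segment, monotone translate, order-interval image — are PROVED here once and for all, so that
a by-value node stated over `Op (PolySite (chainWindow (-1) (n+1))) 4` transports with no side condition:
`lti_primal_chainWindow_energyDensity_ge` (half filling) and `lti_primal_chainWindow_energyDensityAt_ge` (filling `p/q`).
[cite: KullEtAl2024, §II.B, §VI.B] [cite: Han2020Bootstrap, §2]
-/

noncomputable section

open Matrix Complex Filter Topology
open scoped ComplexOrder
open Literature.Probability.LatticeModels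
open Literature.MathematicalPhysics.QuantumLattice
open Literature.MathematicalPhysics.QuantumLattice.HubbardWave0
open Literature.MathematicalPhysics.QuantumLattice.ThermodynamicLimit
open Literature.MathematicalPhysics.QuantumLattice.JordanWigner
open Literature.MathematicalPhysics.QuantumManyBody.StateRelaxation

namespace Summit.Ventures.CertifiedManyBodySolver.Transport

/-! ### Chain windows `{a, …, b} ⊂ ℤ` -/

section Window

/-- The chain window `{a, a+1, …, b} ⊂ ℤ = ℤ¹` as a finite set of sites. [cite: KullEtAl2024, §II.B] -/
def chainWindow (a b : ℤ) : Finset (Site 1) :=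
  (Finset.Icc a b).map ⟨fun z _ => z, fun z w h => by simpa using congrFun h 0⟩

/-- Membership in a chain window is the coordinate bound `a ≤ x₀ ≤ b`. [folklore] -/
theorem mem_chainWindow {a b : ℤ} {x : Site 1} : x ∈ chainWindow a b ↔ a ≤ x 0 ∧ x 0 ≤ b := by
  constructor
  · intro h
    obtain ⟨z, hz, rfl⟩ := Finset.mem_map.1 h
    exact Finset.mem_Icc.1 hz
  · intro h
    refine Finset.mem_map.2 ⟨x 0, Finset.mem_Icc.2 h, funext fun i => ?_⟩
    rw [Subsingleton.elim i 0]
    rfl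

/-- Chain windows are monotone in the right end point. [folklore] -/
theorem chainWindow_mono_right (a : ℤ) {b b' : ℤ} (h : b ≤ b') : chainWindow a b ⊆ chainWindow a b' := fun x hx => by
  rw [mem_chainWindow] at hx ⊢
  exact ⟨hx.1, hx.2.trans h⟩

/-- The unit translate of `{a, …, b}` lies in `{a, …, b+1}`. [folklore] -/
theorem affShiftSet_chainWindow_subset (a b : ℤ) :
    affShiftSet 1 (unitVec 0) (chainWindow a b) ⊆ chainWindow a (b + 1) := by
  intro x hx
  obtain ⟨y, hy, rfl⟩ := Finset.mem_map.1 hx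
  rw [mem_chainWindow] at hy
  rw [mem_chainWindow]
  simp only [Function.Embedding.coeFn_mk, affSite_apply, Units.val_one, one_mul, unitVec, Pi.single_eq_same]
  omega

/-- `{-1, 0, 1} ⊆ {-1, …, b}` for `b ≥ 1`. [folklore] -/
theorem thicken_zero_one_subset_chainWindow {b : ℤ} (hb : 1 ≤ b) :
    thicken ({0} : Finset (Site 1)) 1 ⊆ chainWindow (-1) b := by
  intro x hx
  rw [thicken_singleton_zero_one, mem_box] at hx
  rw [mem_chainWindow]
  have h := hx 0
  push_cast at h
  omega

/-- `0 ∈ {-1, …, b}` for `b ≥ 0`. [folklore] -/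
theorem zero_mem_chainWindow {b : ℤ} (hb : 0 ≤ b) : (0 : Site 1) ∈ chainWindow (-1) b := by
  rw [mem_chainWindow]
  simp only [Pi.zero_apply]
  omega

/-- The site order of `ℤ¹` is the order of the coordinate: `p ≤ q ↔ p₀ ≤ q₀`. [folklore] -/
theorem PolySite.le_iff_apply {Λ : Finset (Site 1)} (p q : PolySite Λ) : p ≤ q ↔ ofLex p.1 0 ≤ ofLex q.1 0 := by
  rw [← Subtype.coe_le_coe]
  exact Pi.lex_le_iff_of_unique

/-- The site order of `ℤ¹` is the order of the coordinate: `p < q ↔ p₀ < q₀`. [folklore] -/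
theorem PolySite.lt_iff_apply {Λ : Finset (Site 1)} (p q : PolySite Λ) : p < q ↔ ofLex p.1 0 < ofLex q.1 0 := by
  rw [← Subtype.coe_lt_coe]
  exact Pi.Lex.lt_iff_of_unique

/-- The range of the inclusion `Λ₀ ↪ Λ'` consists of the sites of `Λ'` lying in `Λ₀`. [folklore] -/
theorem PolySite.mem_range_incl_iff {d : ℕ} {Λ₀ Λ' : Finset (Site d)} (h : Λ₀ ⊆ Λ') (q : PolySite Λ') :
    q ∈ Set.range (PolySite.incl h) ↔ ofLex q.1 ∈ Λ₀ := by
  constructor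
  · rintro ⟨y, rfl⟩
    exact PolySite.ofLex_mem y
  · intro hq
    exact ⟨⟨q.1, mem_lexSites.2 hq⟩, Subtype.ext rfl⟩

/-- **Initial segment**: the sites of `{-1, …, n}` form a lower set of the sites of `{-1, …, b}`. [folklore] -/
theorem isLowerSet_range_incl_chainWindow {n b : ℤ} (h : chainWindow (-1) n ⊆ chainWindow (-1) b) :
    IsLowerSet (Set.range (PolySite.incl h)) := by
  intro q p hpq hq
  rw [PolySite.mem_range_incl_iff, mem_chainWindow] at hq ⊢
  rw [PolySite.le_iff_apply] at hpq
  have hp := (mem_chainWindow.1 (PolySite.ofLex_mem p)).1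
  exact ⟨hp, le_trans hpq hq.2⟩

/-- **The unit translation is strictly monotone** on the sites of a chain window. [folklore] -/
theorem strictMono_affEmb_trans_incl {Λ₀ Λ' : Finset (Site 1)} (hsh : affShiftSet 1 (unitVec 0) Λ₀ ⊆ Λ') :
    StrictMono ((PolySite.affEmb 1 (unitVec 0) Λ₀).trans (PolySite.incl hsh)) := by
  intro y y' hyy
  rw [PolySite.lt_iff_apply] at hyy ⊢
  simp only [Function.Embedding.trans_apply, PolySite.coe_incl, PolySite.ofLex_coe_affEmb, affSite_apply, Units.val_one,
    one_mul]
  linarith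

/-- The image of `{-1, …, n}` under the unit translation into `{-1, …, n+1}` consists of the sites with coordinate `≥ 0`.
[folklore] -/
theorem mem_range_affEmb_trans_incl_iff (n : ℤ)
    (hsh : affShiftSet 1 (unitVec 0) (chainWindow (-1) n) ⊆ chainWindow (-1) (n + 1)) (r : PolySite (chainWindow (-1) (n + 1))) :
    r ∈ Set.range ((PolySite.affEmb 1 (unitVec 0) (chainWindow (-1) n)).trans (PolySite.incl hsh)) ↔ 0 ≤ ofLex r.1 0 := by
  constructor
  · rintro ⟨y, rfl⟩
    have hy := (mem_chainWindow.1 (PolySite.ofLex_mem y)).1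
    simp only [Function.Embedding.trans_apply, PolySite.coe_incl, PolySite.ofLex_coe_affEmb, affSite_apply, Units.val_one,
      one_mul, unitVec, Pi.single_eq_same]
    omega
  · intro hr
    have hr' := mem_chainWindow.1 (PolySite.ofLex_mem r)
    have hy : (fun _ : Fin 1 => ofLex r.1 0 - 1) ∈ chainWindow (-1) n := by
      rw [mem_chainWindow]
      omega
    refine ⟨PolySite.pt _ hy, Subtype.ext ?_⟩
    have hsite : affSite 1 (unitVec 0) (fun _ : Fin 1 => ofLex r.1 0 - 1) = ofLex r.1 := by
      funext i
      rw [Subsingleton.elim i 0, affSite_apply, Units.val_one, one_mul, unitVec, Pi.single_eq_same]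
      ring
    show toLex (affSite 1 (unitVec 0) (ofLex (PolySite.pt _ hy).1)) = r.1
    rw [PolySite.ofLex_coe_pt, hsite, toLex_ofLex]

/-- **Order interval**: the image of `{-1, …, n}` under the unit translation is an order-connected set of sites of
`{-1, …, n+1}`. [folklore] -/
theorem ordConnected_range_affEmb_trans_incl (n : ℤ)
    (hsh : affShiftSet 1 (unitVec 0) (chainWindow (-1) n) ⊆ chainWindow (-1) (n + 1)) :
    (Set.range ((PolySite.affEmb 1 (unitVec 0) (chainWindow (-1) n)).trans (PolySite.incl hsh))).OrdConnected := by
  refine Set.ordConnected_iff.2 fun p hp q _ _ r hr => ?_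
  rw [mem_range_affEmb_trans_incl_iff] at hp ⊢
  exact le_trans hp ((PolySite.le_iff_apply p r).1 hr.1)

end Window

/-! ### The canonical window: transport with no side condition -/

section Canonical

/-- **THEOREM B0, fermion case, canonical window, half filling.** For the window `W = {-1, 0, …, n+1}` (`n + 3` sites), its
left sub-window `W₀ = {-1, …, n}` and the unit translation: if `E ≤ Re tr(h ρ)` for every window variable `ρ : Op (PolySite W) 4`
satisfying the rows of the by-value node (density target `1/2`), then `E ≤ hubbardChainEnergyDensity t U` (`U ≥ 0`).
[cite: KullEtAl2024, §II.B, §VI.B] [cite: Han2020Bootstrap, §2] [cite: Ruelle1969, §2.2] -/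
theorem lti_primal_chainWindow_energyDensity_ge (t : ℝ) {U : ℝ} (hU : 0 ≤ U) (n : ℕ) {E : ℝ}
    (hclaim : ∀ ρ : Op (PolySite (chainWindow (-1) ((n : ℤ) + 1))) 4, ρ.PosSemidef → ρ.trace = 1 →
      spinPartialTrace ((PolySite.affEmb 1 (unitVec 0) (chainWindow (-1) (n : ℤ))).trans
          (PolySite.incl (affShiftSet_chainWindow_subset (-1) (n : ℤ)))) ρ =
        spinPartialTrace (PolySite.incl (chainWindow_mono_right (-1) (by omega : (n : ℤ) ≤ n + 1))) ρ →
      (∀ σ : Fin 2, ∀ k k' : TensorIndex (PolySite (chainWindow (-1) ((n : ℤ) + 1))) 4,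
        (∑ x, if σ ∈ siteOcc (k x) then 1 else 0 : ℕ) ≠ (∑ x, if σ ∈ siteOcc (k' x) then 1 else 0 : ℕ) → ρ k k' = 0) →
      (∀ σ : Fin 2, ((toSpin (nAt 0 (zero_mem_chainWindow (by omega : (0 : ℤ) ≤ n + 1)) σ) * ρ).trace).re = 1 / 2) →
      (∀ k k' : TensorIndex (PolySite (chainWindow (-1) ((n : ℤ) + 1))) 4, starRingEnd ℂ (ρ k k') = ρ k k') →
      (∀ k k' : TensorIndex (PolySite (chainWindow (-1) ((n : ℤ) + 1))) 4, ‖ρ k k'‖ ≤ 1) →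
      E ≤ ((toSpin (fermionEmbed (PolySite.incl (thicken_zero_one_subset_chainWindow (by omega : (1 : ℤ) ≤ n + 1)))
        ((hubbardFermionInteraction 1 t U).meanEnergyObs 1)) * ρ).trace).re) :
    E ≤ hubbardChainEnergyDensity t U :=
  lti_primal_chainEnergyDensity_ge t hU _ (unitVec 0) _ _ _ (isLowerSet_range_incl_chainWindow _)
    (strictMono_affEmb_trans_incl _) (ordConnected_range_affEmb_trans_incl (n : ℤ) _) hclaim

/-- **THEOREM B0, fermion case, canonical window, filling `p/q`.** As `lti_primal_chainWindow_energyDensity_ge`, with density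
target `p/(2q)` per spin (`1 ≤ q`, `p ≤ 2q`, `U ≥ 0`): `E ≤ hubbardChainEnergyDensityAt t U p q`.
[cite: KullEtAl2024, §II.B, §VI.B] [cite: Han2020Bootstrap, §2] [cite: Ruelle1969, §2.2] -/
theorem lti_primal_chainWindow_energyDensityAt_ge (t : ℝ) {U : ℝ} (hU : 0 ≤ U) {p q : ℕ} (hq : 1 ≤ q) (hp : p ≤ 2 * q)
    (n : ℕ) {E : ℝ}
    (hclaim : ∀ ρ : Op (PolySite (chainWindow (-1) ((n : ℤ) + 1))) 4, ρ.PosSemidef → ρ.trace = 1 →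
      spinPartialTrace ((PolySite.affEmb 1 (unitVec 0) (chainWindow (-1) (n : ℤ))).trans
          (PolySite.incl (affShiftSet_chainWindow_subset (-1) (n : ℤ)))) ρ =
        spinPartialTrace (PolySite.incl (chainWindow_mono_right (-1) (by omega : (n : ℤ) ≤ n + 1))) ρ →
      (∀ σ : Fin 2, ∀ k k' : TensorIndex (PolySite (chainWindow (-1) ((n : ℤ) + 1))) 4,
        (∑ x, if σ ∈ siteOcc (k x) then 1 else 0 : ℕ) ≠ (∑ x, if σ ∈ siteOcc (k' x) then 1 else 0 : ℕ) → ρ k k' = 0) →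
      (∀ σ : Fin 2, ((toSpin (nAt 0 (zero_mem_chainWindow (by omega : (0 : ℤ) ≤ n + 1)) σ) * ρ).trace).re =
        (p : ℝ) / (2 * (q : ℝ))) →
      (∀ k k' : TensorIndex (PolySite (chainWindow (-1) ((n : ℤ) + 1))) 4, starRingEnd ℂ (ρ k k') = ρ k k') →
      (∀ k k' : TensorIndex (PolySite (chainWindow (-1) ((n : ℤ) + 1))) 4, ‖ρ k k'‖ ≤ 1) →
      E ≤ ((toSpin (fermionEmbed (PolySite.incl (thicken_zero_one_subset_chainWindow (by omega : (1 : ℤ) ≤ n + 1)))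
        ((hubbardFermionInteraction 1 t U).meanEnergyObs 1)) * ρ).trace).re) :
    E ≤ hubbardChainEnergyDensityAt t U p q :=
  lti_primal_chainEnergyDensityAt_ge t hU hq hp _ (unitVec 0) _ _ _ (isLowerSet_range_incl_chainWindow _)
    (strictMono_affEmb_trans_incl _) (ordConnected_range_affEmb_trans_incl (n : ℤ) _) hclaim

end Canonical

end Summit.Ventures.CertifiedManyBodySolver.Transport
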